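import Summits.Ventures.GridStability.Lyapunov.AdmittanceWeightBounds
import Summits.Ventures.GridStability.Lyapunov.StructurePreservingPolytopeLevel
import Literature.MathematicalPhysics.PowerSystems.DVOCStabilityCondition
import HarnessLib

/-!
# Condition 2 of [GrossEtAl2019] at a typed operating point: the node terms in exact rational form (G2-SCALE Q2, D42′)

Venture GRIDFUSION, G2-SCALE cell (lead g19 §29 D42′ «CS19-YES(op)»: v⋆ ≡ 1, θ⋆ = the feeder file's typed half-angle column
`θ_k = 2·arctan t_k`, node terms bounded IN THE KERNEL; crit-1 K-A3 l.10318), owner gridfusion-sos-5 g9. With flat voltage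
magnitudes and half-angle-tangent angles the Condition-2 row sum of `DvocReduced.decreaseOnS_of_condition2` is EXACTLY
`Σ_j w_kj · pairGap(t_j, t_k)` with the rational `pairGap a b = 2q²/(1 + q²) = 1 − cos(2·arctan a − 2·arctan b)`,
`q = (a − b)/(1 + ab)` (the tree's `StructurePreserving.cos_halfAngle_sub`); bounding the real weights by rational UPPER
brackets (`AdmittanceWeightBounds`) makes every node term a sparse rational sum `nodeBound` (one pass over the bracket row),
so the node-wise Condition 2 becomes ONE `decide` over `ℚ`. Also: the exact `cos θ̄` of the global angle spread
(`cos_spread_eq`) and the projection lemma letting a lower-bracket and an upper-bracket impedance list share one real kernel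
(`admittanceKernel_eq_of_rxProj_eq`). THREE COLUMNS. CERTIFIED (kernel): everything here. VALIDATED / MODELLED: nothing.
[cite: GrossEtAl2019, Condition 2 and Proposition 3]
-/

namespace Summit.Ventures.GridStability.Lyapunov

open Real Finset
open Literature.MathematicalPhysics.PowerSystems
open Literature.Computation.Certificates Literature.Computation.Certificates.PSD
open Summit.Ventures.GridStability.Lyapunov.StructurePreserving (hq cos_halfAngle_sub abs_halfAngle_sub_lt_pi)

/-! ## The pair term `1 − cos(θ_j − θ_k)` as a rational function of the half-angle tangents -/

/-- `pairGap a b = 2q²/(1 + q²)`, `q = (a − b)/(1 + ab)` — equals `1 − cos(2·arctan a − 2·arctan b)`. [folklore] -/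
def pairGap (a b : ℚ) : ℚ := 2 * ((a - b) / (1 + a * b)) ^ 2 / (1 + ((a - b) / (1 + a * b)) ^ 2)

/-- `pairGap ≥ 0`. [folklore] -/
theorem pairGap_nonneg (a b : ℚ) : 0 ≤ pairGap a b := by unfold pairGap; positivity

/-- **`1 − cos(2·arctan a − 2·arctan b) = pairGap a b`** for `ab > −1` (half-angle substitution). [folklore] -/
theorem one_sub_cos_halfAngle (a b : ℚ) (hab : -1 < a * b) :
    1 - Real.cos (2 * Real.arctan (a : ℝ) - 2 * Real.arctan (b : ℝ)) = (pairGap a b : ℝ) := by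
  rw [cos_halfAngle_sub (by exact_mod_cast hab)]
  unfold pairGap hq
  have hq1 : (0 : ℝ) < 1 + (((a : ℝ) - b) / (1 + a * b)) ^ 2 := by positivity
  push_cast
  field_simp
  ring

/-- **The exact cosine of the global angle spread** `θ̄ = 2·arctan a − 2·arctan b`: `cos θ̄ = 1 − pairGap a b`. [folklore] -/
theorem cos_spread_eq (a b : ℚ) (hab : -1 < a * b) :
    Real.cos (2 * Real.arctan (a : ℝ) - 2 * Real.arctan (b : ℝ)) = 1 - (pairGap a b : ℝ) := by
  linarith [one_sub_cos_halfAngle a b hab]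

/-! ## The node term at `v⋆ ≡ 1` with typed half-angle angles -/

/-- **Exact node term**: with `v⋆ ≡ 1` and `θ_k = 2·arctan t_k` (`t_j t_k > −1`), the Condition-2 row sum is
`Σ_j w_kj · pairGap(t_j, t_k)`. [cite: GrossEtAl2019, Condition 2] -/
theorem nodeGainAbs_eq_sum_pairGap {N : ℕ} (W : DvocReduced N) (hv : ∀ k, W.vref k = 1) (t : Fin N → ℚ)
    (hθ : ∀ k, W.θ k = 2 * Real.arctan (t k : ℝ)) (ht : ∀ j k, -1 < t j * t k) (k : Fin N) :
    W.nodeGainAbs k = ∑ j, W.w k j * (pairGap (t j) (t k) : ℝ) := by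
  unfold DvocReduced.nodeGainAbs
  refine Finset.sum_congr rfl fun j _ => ?_
  rw [hv j, hv k, div_one, one_mul, hθ j, hθ k, ← one_sub_cos_halfAngle _ _ (ht j k),
    abs_of_nonneg (by linarith [Real.cos_le_one (2 * Real.arctan (t j : ℝ) - 2 * Real.arctan (t k : ℝ))])]

/-- **Node term ≤ the upper-bracket sum**: `w ≤ B` entrywise gives `Σ_j w_kj pairGap ≤ Σ_j B_kj pairGap`.
[cite: GrossEtAl2019, Condition 2] -/
theorem nodeGainAbs_le_sum_upper {N : ℕ} (W : DvocReduced N) (hv : ∀ k, W.vref k = 1) (t : Fin N → ℚ)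
    (hθ : ∀ k, W.θ k = 2 * Real.arctan (t k : ℝ)) (ht : ∀ j k, -1 < t j * t k)
    (B : Fin N → Fin N → ℝ) (hwB : ∀ k j, W.w k j ≤ B k j) (k : Fin N) :
    W.nodeGainAbs k ≤ ∑ j, B k j * (pairGap (t j) (t k) : ℝ) := by
  rw [nodeGainAbs_eq_sum_pairGap W hv t hθ ht k]
  exact Finset.sum_le_sum fun j _ =>
    mul_le_mul_of_nonneg_right (hwB k j) (by exact_mod_cast pairGap_nonneg (t j) (t k))

/-- **Sparse evaluation of the upper-bracket node sum**: for `B = matrixOfSparseRows N N Wp` and `t_j = tl.getD j 0`,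
`Σ_j B_kj pairGap(t_j, t_k)` is the one-pass list sum `nodeBound`. [cite: BarrettEtAl1994, §4.3.2 «CRS Matrix-Vector Product», p. 61] -/
def nodeBound (Wp : SMat ℚ) (tl : List ℚ) (k : ℕ) : ℚ :=
  ((Wp.getD k []).map fun p => p.2 * pairGap (tl.getD p.1 0) (tl.getD k 0)).sum

/-- The dense upper-bracket node sum equals `nodeBound` (columns in range). [cite: BarrettEtAl1994, §4.3.2, p. 61] -/
theorem sum_upper_pairGap_eq_nodeBound {N : ℕ} (Wp : SMat ℚ) (hW : colsBelow N Wp = true) (tl : List ℚ) (k : Fin N) :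
    ∑ j : Fin N, matrixOfSparseRows N N Wp k j * pairGap (tl.getD j.val 0) (tl.getD k.val 0) = nodeBound Wp tl k.val := by
  unfold nodeBound
  simp only [matrixOfSparseRows_apply]
  exact sum_fn_mul _ (all_lt_of_colsBelow hW k.val) (fun j => pairGap (tl.getD j 0) (tl.getD k.val 0))

/-! ## One real kernel from two bracket lists -/

/-- The `(j, r, x)` projection of impedance rows (drops the bracket). [folklore] -/
def rxProj (ZW : ZWRows) : List (List (ℕ × ℚ × ℚ)) := ZW.map fun row => row.map fun p => (p.1, p.2.1, p.2.2.1)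

/-- Two impedance lists with the same `(j, r, x)` projection (e.g. a LOWER- and an UPPER-bracket typing of one feeder) define the
same real admittance kernel. [cite: GrossEtAl2019, eq. (1)] -/
theorem admittanceKernel_eq_of_rxProj_eq {N : ℕ} {Z₁ Z₂ : ZWRows} (h : rxProj Z₁ = rxProj Z₂) :
    admittanceKernel N Z₁ = admittanceKernel N Z₂ := by
  have key : ∀ Z : ZWRows, ∀ i : ℕ, admittanceRow (Z.getD i [])
      = ((rxProj Z).getD i []).map fun tr => (tr.1, admittance tr.2.1 tr.2.2) := by
    intro Z i
    rw [rxProj, List.getD_eq_getElem?_getD, List.getD_eq_getElem?_getD, List.getElem?_map]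
    cases Z[i]? with
    | none => rfl
    | some row => simp [admittanceRow, List.map_map, Function.comp_def]
  funext i j
  unfold admittanceKernel
  rw [key Z₁, key Z₂, h]

/-- Hence also the same symmetrised kernel. [folklore] -/
theorem admittanceKernelSym_eq_of_rxProj_eq {N : ℕ} {Z₁ Z₂ : ZWRows} (h : rxProj Z₁ = rxProj Z₂) :
    admittanceKernelSym N Z₁ = admittanceKernelSym N Z₂ := by
  funext i j; unfold admittanceKernelSym; rw [admittanceKernel_eq_of_rxProj_eq h]

/-- **Upper brackets for the symmetrised kernel**: `upperCheck` + a symmetric bracket matrix give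
`admittanceKernelSym ≤ matrixOfSparseRows N N (bracketSMat ZWup)` entrywise. [cite: GrossEtAl2019, eq. (1)] -/
theorem admittanceKernelSym_le_of_upperCheck {N d : ℕ} (ZW : ZWRows) (h : upperCheck ZW = true) (hd : N ≤ 2 ^ d)
    (hsym : SMat.eqCheck N (bracketSMat ZW) (SMat.transpose d N (bracketSMat ZW)) = true) :
    ∀ i j : Fin N, admittanceKernelSym N ZW i j ≤ ((matrixOfSparseRows N N (bracketSMat ZW) i j : ℚ) : ℝ) := by
  intro i j
  have h1 := admittanceKernel_le_of_upperCheck N ZW h i j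
  have h2 := admittanceKernel_le_of_upperCheck N ZW h j i
  have hs : matrixOfSparseRows N N (bracketSMat ZW) j i = matrixOfSparseRows N N (bracketSMat ZW) i j :=
    (symm_of_eqCheck_transpose hd _ hsym i j).symm
  rw [hs] at h2
  unfold admittanceKernelSym
  linarith

end Summit.Ventures.GridStability.Lyapunov
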